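import Mathlib
import HarnessLib
import Summits.Ventures.LatticeQCDFlow.Exactness.SpreadingKernelLemmas
import Summits.Ventures.LatticeQCDFlow.Exactness.MetropolisSweepConvergence
import Summits.Ventures.LatticeQCDFlow.Exactness.DoeblinUniqueness

/-!
# Exact steps interleaved with a locally spreading update keep a Doeblin power: `update + over-relaxation` composites on compact connected spaces converge from every start

HONEST FRAMING: exact (Metropolis-corrected) sampling algorithms for lattice gauge theory;
figures of merit are autocorrelation/cost numbers at stated couplings and volumes; no
continuum-physics claim.

Venture `LatticeQCDFlow` (cell pub-lqcd), topic `Exactness`, FANOUT row 9 (eng-latcore, the engine's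
COMPOSITE sweeps `latflow.core.updates.composite_sweep(f, β, 'metro' | 'hb' | 'hmc', n_or)`: one
Metropolis / heat-bath / HMC update then `n_or` over-relaxation sweeps — the TYPED-EXACTNESS-MAP item
open since gen-13, "`'metro' + 'or'` on gauge groups: a Doeblin POWER does not survive interleaving").
NEW WORK of the cell over the tree (`SpreadingKernelLemmas.lean`: uniform ball bound, thin points are
few, thickening gains a ball, the spreading step, one round; `InvariantComposition.lean`: `nHit`; `RefreshScan.lean`:
`minorised_comp_left/right`; `MetropolisSweepConvergence.lean`: `uniformlyErgodic_of_nHit_minorised`;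
`DoeblinUniqueness.lean`: `invariant_unique_of_minorised`).  Nothing is cited as a fact; no number is
claimed.  Printed counterpart, NAMED ONLY: Meyn–Tweedie 1993 ch. 16 (small sets, `m`-skeletons).

THE POINT.  The tree makes a Metropolis sweep on a compact group uniformly ergodic through the
RANDOM-WALK structure of its kicks (`MetropolisSweepErgodic.lean`, `ConnectedGroupKickCovering.lean`);
an over-relaxation map between two sweeps is not a translation, so that argument does not survive
interleaving, and the engine's OR map is not even continuous (identity on the degenerate-staple set).
Here NO structure is asked of the interleaved step: on a compact preconnected pseudo-metric space `X`
with a finite Borel measure `π` charging every ball, let `K` SPREAD LOCALLY, `K(y, ·) ≥ c · π|_{B(y, r)}`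
for every `y`, and let `P` be ANY Markov kernel leaving `π` invariant (deterministic or not, continuous
or not).  Then some power of `P ∘ₖ K` ("`K` then `P`") dominates `a · π` from EVERY point, `a ≠ 0`, and
so does some power of `K ∘ₖ P`.  Mechanism: after `k` rounds the law from `x` dominates
`a_k · (π|_{A_k}) P` with `π(A_k)` growing by a fixed `v/2` per round until `A_k = X` — (i) if `σ ≤ π`
then `σ K` has `π`-density `≥ c θ` on the `r/2`-thickening of the `θ`-thick points
`C' = {w : σ(B(w, r/2)) ≥ θ}` of `σ`; (ii) thin points carry `σ`-mass `≤ N θ ≤ v/2` whatever `P` did;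
(iii) by connectedness the thickening gains a disjoint `r/4`-ball of `π`-measure `≥ v`; `π(X) < ∞`
stops the count uniformly in `x`.

* §1 (the round itself is `spreading_round`, `SpreadingKernelLemmas.lean` §5 — the closing exact step may
  differ from the previous one; schedules: `SpreadingKernelSchedules.lean`) **`exists_nHit_comp_minorised`**
  (`∃ m, ∃ a ≠ 0, ∀ x, a • π ≤ (P ∘ₖ K)^{m+1} x`), `nHit_comp_swap`, **`exists_nHit_comp_minorised'`**
  (the same for `K ∘ₖ P` when `K` also leaves `π` invariant).
* §2 **`spreading_comp_uniformlyErgodic`** / **`spreading_comp_uniformlyErgodic'`** — for `π` a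
  probability law invariant under the Markov kernels `K` (locally spreading) and `P`:
  `|μ₀ (P ∘ₖ K)ᵗ(A) − π(A)| ≤ (1 − ε)^{⌊t/(m+1)⌋}` for some `m` and `ε ∈ (0, 1]`, EVERY initial law,
  every `t`, every `A`, and `π` is the unique invariant probability law of the composite (both orders).

NOT CLAIMED: any value of `m` or `ε` (compactness + connectedness: astronomically bad); that a given
engine update spreads locally (instances are separate files); non-compact or disconnected state spaces
(false there — OR alone is never ergodic, `OverrelaxationNotErgodic.lean`); floating point.
-/

noncomputable section

namespace Summit.Ventures.LatticeQCDFlow.Exactness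

open MeasureTheory Measure Metric Set Filter Topology Function ProbabilityTheory ProbabilityTheory.Kernel
open scoped ENNReal

variable {X : Type*} [PseudoMetricSpace X] [MeasurableSpace X] [BorelSpace X] [SecondCountableTopology X]

/-! ## §1 The iteration: the thick set grows by a fixed amount each round -/

section Iteration

variable [CompactSpace X] [PreconnectedSpace X] {π : Measure X} [IsFiniteMeasure π]
  {K P : Kernel X X} [IsMarkovKernel P] {c : ℝ≥0∞} {r : ℝ}

/-- **A POWER OF `P ∘ₖ K` IS DOEBLIN.**  On a compact preconnected space with a finite measure `π`
charging every ball: if `K(y, ·) ≥ c · π|_{B(y, r)}` for all `y` (`c ≠ 0`, `r > 0`) and `P` is a Markov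
kernel leaving `π` invariant, then there are `m` and `a ≠ 0` with `a • π ≤ (P ∘ₖ K)^{m+1} x` for EVERY
`x`. -/
theorem exists_nHit_comp_minorised (hP : Invariant P π) (hr : 0 < r) (hc : c ≠ 0)
    (hK : ∀ y, c • π.restrict (ball y r) ≤ K y) (hpos : ∀ (x : X) (ρ : ℝ), 0 < ρ → π (ball x ρ) ≠ 0) :
    ∃ m : ℕ, ∃ a : ℝ≥0∞, a ≠ 0 ∧ ∀ x, a • π ≤ nHit (P ∘ₖ K) (m + 1) x := by
  rcases isEmpty_or_nonempty X with hX | ⟨⟨x₀⟩⟩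
  · exact ⟨0, 1, one_ne_zero, fun x => (IsEmpty.false x).elim⟩
  -- the constants
  obtain ⟨v, hv0, hv⟩ := exists_le_measure_ball π hpos (show 0 < r / 4 by positivity)
  have hvtop : v ≠ ⊤ := ne_top_of_le_ne_top (measure_ne_top π _) (hv x₀)
  obtain ⟨N, hN⟩ := exists_coverNumber (X := X) (show 0 < r / 2 by positivity)
  set θ : ℝ≥0∞ := v / 2 / ((N : ℝ≥0∞) + 1) with hθ
  have hN1 : ((N : ℝ≥0∞) + 1) ≠ 0 := by simp
  have hN1top : ((N : ℝ≥0∞) + 1) ≠ ⊤ := by simp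
  have hv2 : v / 2 ≠ 0 := (ENNReal.div_pos_iff.2 ⟨hv0, ENNReal.ofNat_ne_top⟩).ne'
  have hθ0 : θ ≠ 0 := (ENNReal.div_pos_iff.2 ⟨hv2, hN1top⟩).ne'
  have hθv : θ ≤ v := by
    rw [hθ]
    refine (ENNReal.div_le_of_le_mul ?_).trans ENNReal.half_le_self
    exact le_mul_of_one_le_right zero_le (by simp)
  have hNθ : (N : ℝ≥0∞) * θ ≤ v / 2 := by
    rw [hθ]
    calc (N : ℝ≥0∞) * (v / 2 / ((N : ℝ≥0∞) + 1)) ≤ ((N : ℝ≥0∞) + 1) * (v / 2 / ((N : ℝ≥0∞) + 1)) :=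
          mul_le_mul' (by simp) le_rfl
      _ = v / 2 := ENNReal.mul_div_cancel hN1 hN1top
  -- the rounds
  have key : ∀ k : ℕ, ∀ x, ∃ A : Set X, (v + k * (v / 2) ≤ π A ∨ A = univ) ∧
      (c * (c * θ) ^ k) • (π.restrict A).bind P ≤ nHit (P ∘ₖ K) (k + 1) x := by
    intro k
    induction k with
    | zero =>
        intro x
        refine ⟨ball x r, Or.inl ?_, ?_⟩
        · rw [Nat.cast_zero, zero_mul, add_zero]
          exact (hv x).trans (measure_mono (ball_subset_ball (by linarith)))
        · rw [pow_zero, mul_one, zero_add, nHit_succ, nHit_zero, Kernel.comp_id, Kernel.comp_apply]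
          calc c • (π.restrict (ball x r)).bind P = (c • π.restrict (ball x r)).bind P :=
                (Measure.bind_smul _ _ _).symm
            _ ≤ (K x).bind P := bind_mono_left (hK x) P
    | succ k ih =>
        intro x
        obtain ⟨A, hlo, hmin⟩ := ih x
        obtain ⟨A', -, hlo', hmin'⟩ := spreading_round hP P hr hK hv0 hvtop hv hN hθv hNθ
          (b := v + k * (v / 2)) le_self_add hlo hmin
        refine ⟨A', ?_, ?_⟩
        · rcases hlo' with h | h
          · left
            rw [Nat.cast_succ, add_mul, one_mul, ← add_assoc]
            exact h
          · exact Or.inr h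
        · rw [nHit_succ, Kernel.comp_apply, bind_kernel_comp, pow_succ, ← mul_assoc]
          exact hmin'
  -- termination: the measure cannot grow forever
  obtain ⟨n, hn⟩ := ENNReal.exists_nat_mul_gt (a := v / 2) (b := π univ)
    (ENNReal.div_pos_iff.2 ⟨hv0, ENNReal.ofNat_ne_top⟩).ne' (measure_ne_top π univ)
  refine ⟨n, c * (c * θ) ^ n, mul_ne_zero hc (pow_ne_zero _ (mul_ne_zero hc hθ0)), fun x => ?_⟩
  obtain ⟨A, hlo, hmin⟩ := key n x
  have hAu : A = univ := by
    rcases hlo with h | h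
    · exfalso
      have h' : π univ < π A := hn.trans_le (le_add_self.trans h)
      exact absurd (measure_mono (subset_univ A)) (not_le.2 h')
    · exact h
  rw [hAu, Measure.restrict_univ, hP.def] at hmin
  exact hmin

omit [PseudoMetricSpace X] [BorelSpace X] [SecondCountableTopology X] [CompactSpace X] [PreconnectedSpace X]
  [IsFiniteMeasure π] [IsMarkovKernel P] in
/-- Powers of `K ∘ₖ P` and of `P ∘ₖ K` interlace: `(K ∘ₖ P)^{n+1} = K ∘ₖ (P ∘ₖ K)^n ∘ₖ P`. -/
theorem nHit_comp_swap (K P : Kernel X X) :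
    ∀ n : ℕ, nHit (K ∘ₖ P) (n + 1) = K ∘ₖ (nHit (P ∘ₖ K) n ∘ₖ P)
  | 0 => by rw [zero_add, nHit_succ, nHit_zero, nHit_zero, Kernel.comp_id, Kernel.id_comp]
  | n + 1 => by
      rw [nHit_succ, nHit_comp_swap K P n, nHit_succ]
      simp only [Kernel.comp_assoc]

/-- **A POWER OF `K ∘ₖ P` IS DOEBLIN TOO** (`P` first, then `K`), when `K` also leaves `π` invariant:
`a • π ≤ (K ∘ₖ P)^{m+2} x` for every `x`. -/
theorem exists_nHit_comp_minorised' [IsMarkovKernel K] (hKinv : Invariant K π) (hP : Invariant P π)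
    (hr : 0 < r) (hc : c ≠ 0) (hK : ∀ y, c • π.restrict (ball y r) ≤ K y)
    (hpos : ∀ (x : X) (ρ : ℝ), 0 < ρ → π (ball x ρ) ≠ 0) :
    ∃ m : ℕ, ∃ a : ℝ≥0∞, a ≠ 0 ∧ ∀ x, a • π ≤ nHit (K ∘ₖ P) (m + 2) x := by
  obtain ⟨m, a, ha, hmin⟩ := exists_nHit_comp_minorised hP hr hc hK hpos
  refine ⟨m, a, ha, fun x => ?_⟩
  rw [nHit_comp_swap K P (m + 1)]
  have h1 : ∀ y, a • π ≤ (nHit (P ∘ₖ K) (m + 1) ∘ₖ P) y := minorised_comp_right hmin P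
  have h2 := minorised_comp_left h1 K x
  rwa [hKinv.def] at h2

end Iteration

/-! ## §2 Consequences: convergence from every start and uniqueness of the invariant law -/

section Consequences

variable [CompactSpace X] [PreconnectedSpace X] {π : Measure X} [IsProbabilityMeasure π]
  {K P : Kernel X X} [IsMarkovKernel K] [IsMarkovKernel P] {c : ℝ≥0∞} {r : ℝ}

/-- **`K` THEN `P` CONVERGES FROM EVERY START, AT EVERY TIME, AND HAS `π` AS ITS ONLY INVARIANT LAW.**
For a probability law `π` on a compact preconnected space charging every ball, invariant under the
Markov kernels `K` (spreading locally: `K(y, ·) ≥ c · π|_{B(y, r)}`, `c ≠ 0`, `r > 0`) and `P` (anything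
exact): there are `m` and `ε ∈ (0, 1]` with `|μ₀ (P ∘ₖ K)ᵗ(A) − π(A)| ≤ (1 − ε)^{⌊t/(m+1)⌋}` for EVERY
initial law `μ₀`, every `t`, every `A`; and every invariant probability law of `P ∘ₖ K` is `π`. -/
theorem spreading_comp_uniformlyErgodic (hKinv : Invariant K π) (hP : Invariant P π) (hr : 0 < r)
    (hc : c ≠ 0) (hK : ∀ y, c • π.restrict (ball y r) ≤ K y)
    (hpos : ∀ (x : X) (ρ : ℝ), 0 < ρ → π (ball x ρ) ≠ 0) :
    ∃ m : ℕ, ∃ ε : ℝ, 0 < ε ∧ ε ≤ 1 ∧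
      (∀ (μ₀ : Measure X) [IsProbabilityMeasure μ₀] (t : ℕ) (A : Set X),
        |((fun ν : Measure X => ν.bind (P ∘ₖ K))^[t] μ₀).real A - π.real A| ≤ (1 - ε) ^ (t / (m + 1))) ∧
      ∀ (π' : Measure X) [IsProbabilityMeasure π'], Invariant (P ∘ₖ K) π' → π' = π := by
  obtain ⟨m, a, ha0, hmin⟩ := exists_nHit_comp_minorised hP hr hc hK hpos
  obtain ⟨x₀⟩ := nonempty_of_isProbabilityMeasure π
  have hinv : Invariant (P ∘ₖ K) π := hP.comp hKinv
  haveI : IsMarkovKernel (nHit (P ∘ₖ K) (m + 1)) := isMarkovKernel_nHit _ _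
  have ha1 : a ≤ 1 := by
    have h := Measure.le_iff'.1 (hmin x₀) univ
    rwa [Measure.smul_apply, smul_eq_mul, measure_univ, measure_univ, mul_one] at h
  have hatop : a ≠ ⊤ := ne_top_of_le_ne_top ENNReal.one_ne_top ha1
  refine ⟨m, a.toReal, ENNReal.toReal_pos ha0 hatop, ENNReal.toReal_le_of_le_ofReal zero_le_one
    (by rwa [ENNReal.ofReal_one]), fun μ₀ _ t A => uniformlyErgodic_of_nHit_minorised hmin hinv μ₀ t A,
    fun π' _ hπ' => ?_⟩
  exact invariant_unique_of_minorised (κ := nHit (P ∘ₖ K) (m + 1)) hmin (pos_iff_ne_zero.2 ha0)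
    (invariant_nHit hinv _) (invariant_nHit hπ' _)

/-- **`P` THEN `K` CONVERGES FROM EVERY START TOO** (the engine's order "over-relax, then update" or a
cyclic shift of "update, then over-relax"): `|μ₀ (K ∘ₖ P)ᵗ(A) − π(A)| ≤ (1 − ε)^{⌊t/(m+1)⌋}`, and `π`
is the unique invariant probability law of `K ∘ₖ P`. -/
theorem spreading_comp_uniformlyErgodic' (hKinv : Invariant K π) (hP : Invariant P π) (hr : 0 < r)
    (hc : c ≠ 0) (hK : ∀ y, c • π.restrict (ball y r) ≤ K y)
    (hpos : ∀ (x : X) (ρ : ℝ), 0 < ρ → π (ball x ρ) ≠ 0) :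
    ∃ m : ℕ, ∃ ε : ℝ, 0 < ε ∧ ε ≤ 1 ∧
      (∀ (μ₀ : Measure X) [IsProbabilityMeasure μ₀] (t : ℕ) (A : Set X),
        |((fun ν : Measure X => ν.bind (K ∘ₖ P))^[t] μ₀).real A - π.real A| ≤ (1 - ε) ^ (t / (m + 1))) ∧
      ∀ (π' : Measure X) [IsProbabilityMeasure π'], Invariant (K ∘ₖ P) π' → π' = π := by
  obtain ⟨m, a, ha0, hmin⟩ := exists_nHit_comp_minorised' hKinv hP hr hc hK hpos
  obtain ⟨x₀⟩ := nonempty_of_isProbabilityMeasure π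
  have hinv : Invariant (K ∘ₖ P) π := hKinv.comp hP
  haveI : IsMarkovKernel (nHit (K ∘ₖ P) (m + 1 + 1)) := isMarkovKernel_nHit _ _
  have ha1 : a ≤ 1 := by
    have h := Measure.le_iff'.1 (hmin x₀) univ
    rwa [Measure.smul_apply, smul_eq_mul, measure_univ, measure_univ, mul_one] at h
  have hatop : a ≠ ⊤ := ne_top_of_le_ne_top ENNReal.one_ne_top ha1
  refine ⟨m + 1, a.toReal, ENNReal.toReal_pos ha0 hatop, ENNReal.toReal_le_of_le_ofReal zero_le_one
    (by rwa [ENNReal.ofReal_one]), fun μ₀ _ t A => uniformlyErgodic_of_nHit_minorised hmin hinv μ₀ t A,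
    fun π' _ hπ' => ?_⟩
  exact invariant_unique_of_minorised (κ := nHit (K ∘ₖ P) (m + 1 + 1)) hmin (pos_iff_ne_zero.2 ha0)
    (invariant_nHit hinv _) (invariant_nHit hπ' _)

end Consequences

end Summit.Ventures.LatticeQCDFlow.Exactness
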